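import Summits.QuantumFields.BalabanUV.Beta.MultiscaleGradientMember
import Summits.QuantumFields.BalabanUV.Beta.MultiscaleGradientSourceLocal
import Summits.QuantumFields.BalabanUV.Beta.MultiscaleSupMemberDirichlet

/-!
# Beta / MultiscaleGradientMemberDirichlet — «19b-Dirichlet»: the GRADIENT member (3.42)₂'s SHAPE for the LOCAL DIRICHLET INVERSES
# `G′ = dirInv (levelOp) χ` at INTERIOR points (the `d_n`-ball of radius `8d+2` about the bond's source inside the domain), flat transport,
# bondwise, level-free, uniformly in the domain, MODULO the owner's binder (FG) (d = 4: `FlatGradientBinderD4.flatGradient_binder_d4`, so NO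
# hypothesis) — the owner's file 19b re-run verbatim over this lineage's «17-Dirichlet» sup member and the localized bricks of 19a
# (brick (b) of the level-free WRS-currency parametrix (w4-d)∕(w4-f); MODEL)

WHAT IS CERTIFIED (kernel, 0 sorry).  **`real_grad_dirInv_le_of_flatGradient`** — in the setting of file 19b (flat `Rm`, constant weight
`c ≡ c₀ ≠ 0`, graded sides + additive datum, (P), `(1+d/2)log L/R ≤ κ`) and for ANY {0,1}-valued `χ`: for `u` supported in cell `k′` with
`|u| ≤ m`, every bond-component `(b,i)` whose `d_n`-ball of radius `8d+2` about `b₋` lies in `{χ = 1}`: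
`|(D G′u)(b,i)| ≤ 𝔅_∇′·n(b₋)·e^{−δ·d_n(b₋,t_{k′})}·m` — ONE power of the local scale; `𝔅_∇′` = file 19b's constant with `μ₀ ↦ min(μ₀,1)` inside
the sup constant `𝔅`.  Patch points (the rest is the owner's proof): `hAf` ON the domain (`levelOp_dirInv_apply_of_mem`), `hsup` from
`real_sup_dirInv_le` on the `(4d+1)`-ball (interiority inherited from the `(8d+2)`-ball by the triangle inequality),
`abs_le_on_unit_ball_loc` ∕ `abs_levelSum_le_on_unit_ball_loc`.
(unit `b2b-balaban-beta-d4-p2`, GEN 11, MODEL crew; journal l.25223; owner's 19b: an4-g46 p244193.)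

HONEST FRAMING: discharging `BetaPertH` makes Bałaban's UV stability UNCONDITIONAL — NOT the continuum limit, NOT the Clay problem.
HONEST DEPENDENCY (verbatim): «continuum YM on T⁴ ⇐ BetaPertH ∧ nine spine estimates (0/9 proved); BetaPertH ⇐ (D1) ∧ (D4) ∧ CAP+tail;
G-an2-4 gates asym, D1 and NE2/3/4.»  THIS MODULE DISCHARGES NOTHING of `BetaPertH`, asserts NOTHING printed and cites nothing as a fact
(ABSOLUTE RULE): [folklore] bookkeeping about the MODEL operator with FLAT transport; nothing of Bałaban's ∇_UG′_□.  LOCATORS (shape only):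
[Balaban1985BackgroundPropagators] Thm 3.1 (3.42) p. 397, (3.86)–(3.88) pp. 408–409.  No class change on row D4 (critical-path width 0;
D4 DISCHARGE NO DATE); NOT BetaPertH, NOT continuum, NOT Clay, NOT summit progress.
-/

open scoped BigOperators
open Finset

namespace Summit.QuantumFields.BalabanUV.Beta.MultiscaleGradientMemberDirichlet

open Summit.QuantumFields.BalabanUV.Beta.BoxPoincare (Box)
open Summit.QuantumFields.BalabanUV.Beta.MultiscaleCoerciveTorus
open Summit.QuantumFields.BalabanUV.Beta.MultiscaleDistance
open Summit.QuantumFields.BalabanUV.Beta.MultiscaleDistanceMetric (sdist_comm sdist_triangle_torus)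
open Summit.QuantumFields.BalabanUV.Beta.MultiscaleDecayBudget
open Summit.QuantumFields.BalabanUV.Beta.AccretiveCombesThomasSandwichSite (sdist_corner_thresholds)
open Summit.QuantumFields.BalabanUV.Beta.MultiscaleBoxDistance (sdist_le_of_dist_le)
open Summit.QuantumFields.BalabanUV.Beta.MultiscaleSupMemberDirichlet (real_sup_dirInv_le)
open Summit.QuantumFields.BalabanUV.Beta.MultiscaleSupMemberBallDirichlet (levelOp_dirInv_apply_of_mem coer_pos_of_margin)
open Summit.QuantumFields.BalabanUV.Beta.MultiscaleGradientSource (covD_flat covLap_flat_component)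
open Summit.QuantumFields.BalabanUV.Beta.MultiscaleGradientSourceLocal (abs_le_on_unit_ball_loc abs_levelSum_le_on_unit_ball_loc)
open Summit.QuantumFields.BalabanUV.Beta.SubsolutionMeanValueBox (Cmv Cmv_pos)
open Literature.MathematicalPhysics.QuantumFieldTheory.Balaban1983to89
open Literature.MathematicalPhysics.QuantumFieldTheory.Balaban1983to89.B9Thm37Glue (covD covDT covD_apply covDT_apply)
open Literature.MathematicalPhysics.QuantumFieldTheory.Balaban1983to89.B9Thm37GluePU (bsrc btgt bsrc_apply btgt_apply)
open Literature.MathematicalPhysics.QuantumFieldTheory.Balaban1983to89.B9Thm37GlueTorusInv (dirInv)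
open Literature.MathematicalPhysics.QuantumFieldTheory.Balaban1983to89.B9Thm37GlueTorusCov (tblk)
open Literature.MathematicalPhysics.QuantumFieldTheory.Balaban1983to89.B9Thm37GlueTorusCovLevels (levelOp levelSum)
open B5TorusCover (UT Ctr ctrU)
open B5Leibniz121 (up dn)

noncomputable section

variable {d : ℕ} {N : Fin d → ℕ} [∀ i, NeZero (N i)]

section Main


variable [NeZero d] {Cp J K : Type} [Fintype Cp] [DecidableEq Cp] [Nonempty Cp]
  [Fintype J] [Fintype K] [DecidableEq K] (S : J → ℕ) (hS : ∀ l, 1 ≤ S l) (hdivS : ∀ l i, S l ∣ N i) (lvl : K → J)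
  (zc : (k : K) → Ctr N (S (lvl k)))
  (hdisj : ∀ k k' v v', cellPt S hS hdivS lvl zc k v = cellPt S hS hdivS lvl zc k' v' → k = k')
  (hcover : ∀ x : UT N, ∃ k, ∃ v : Box d (S (lvl k)), cellPt S hS hdivS lvl zc k v = x)
  (Rm : UT N × Fin d → Cp → Cp → ℝ) (hRm : ∀ b i j, ∑ k, Rm b k i * Rm b k j = if i = j then (1 : ℝ) else 0)
  (T : J → UT N → Cp → Cp → ℝ) (hT : ∀ l x i i', ∑ k, T l x k i * T l x k i' = if i = i' then (1 : ℝ) else 0)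
  (a : J → ℝ) (ha : ∀ j, 0 ≤ a j) (ω : J → UT N → ℝ)
  (hsupp : ∀ l x, ω l (ctrU N (S l) (tblk (hS l) (hdivS l) x)) ≠ 0 → ∃ k v, lvl k = l ∧ cellPt S hS hdivS lvl zc k v = x)
  {amax : ℝ} (hamax : 0 ≤ amax)
  (hscale : ∀ k, a (lvl k) * ω (lvl k) (ctrU N (S (lvl k)) (zc k)) ^ 2 * (S (lvl k) : ℝ) ^ d ≤ amax / (S (lvl k) : ℝ) ^ 2)
  (c : UT N × Fin d → ℝ) {c₀ : ℝ} (hcc : ∀ b, c b = c₀) (hc₀ : c₀ ≠ 0)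
  {L : ℕ} (hL : 1 ≤ L) (e : J → ℕ) (hSe : ∀ l, S l = L ^ e l) {R : ℝ} (hR : 0 < R) {A : ℕ}
  (hadd : ∀ x y : UT N, |(e (lvl (cellOf S hS hdivS lvl zc hcover x)) : ℝ) - e (lvl (cellOf S hS hdivS lvl zc hcover y))| ≤
    A + sdist bsrc btgt (siteScale S hS hdivS lvl zc hcover) x y / R)

include hdisj hT ha hsupp hamax hscale hL e hSe hR hadd hRm hcc hc₀

/-- **THE GRADIENT MEMBER (3.42)₂'s SHAPE FOR THE LOCAL DIRICHLET INVERSES `G′ = dirInv (levelOp) χ` AT INTERIOR POINTS (the `d_n`-ball of radius `8d+2` about `b₋` inside `{χ = 1}`), FLAT TRANSPORT, BONDWISE, LEVEL-FREE, UNIFORMLY IN THE DOMAIN — MODULO (FG)** — the owner's file 19b RE-RUN VERBATIM with `(levelOp)⁻¹ ↦ G′`, the sup member taken from this lineage's «17-Dirichlet» `real_sup_dirInv_le` (hence `μ₀ ↦ min(μ₀,1)` inside `𝔅`), the ball bricks from `MultiscaleGradientSourceLocal`, and `A f = u` read ON the domain.  ORIGINAL DOCSTRING OF 19b: **(3.42)₂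 FOR `levelOp` MODULO THE FLAT POISSON INTERIOR
GRADIENT BINDER (FG).**  In the MODEL setting of `MultiscaleDecay.hc_levelOp` (coercivity `hcoer` with constant `C`, `|c_b| ≤ c_max`,
`0 ≤ κ ≤ 1`, the margin `μ₀ = C − 2d·c_max²κ² − a_max(e^{2dκ} − 1) > 0`) with a CONSTANT bond weight `c ≡ c₀ ≠ 0`, FLAT transport
`Rm_b(k,i) = δ_{ki}`, graded sides with the additive datum, the (P) budget, the rate condition `(1 + d/2)(log L/R) ≤ κ`
(`δ := κ − (1+d/2)(log L/R)`, `Γ := L^A e^{(log L/R)(4d+1)}`, `θ := 1/(4dΓ)`, `𝔅` := the constant of file 17's sup member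
`real_sup_levelOp_inverse_le`), ASSUME (FG) with constants `K₁, K₂ ≥ 0` (a HYPOTHESIS — ABSOLUTE RULE; co-owner beta-d4-p2's GR3 shape):
«`R ≥ 1`, `10R + 4 ≤ N_i`, `|w| ≤ M` and `|(Σ_{b₊=x}c_b² + Σ_{b₋=x}c_b²)·w(x) − (Σ_{b₊=x}c_b²w(b₋) + Σ_{b₋=x}c_b²w(b₊))| ≤ G` for
`dist(x,x₀) ≤ 2R + 2` ⟹ `|w(x₀+e_μ) − w(x₀)| ≤ K₁·M/(R+1) + K₂·(R+1)·G/c₀²`».  THEN for `u` supported in cell `k′` with `|u| ≤ m` and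
every bond-component `(b, i)`:
`|(D (levelOp)⁻¹u)(b,i)| ≤ |c₀|·(𝔅(Γ²e^δ + 1)·16dΓ + K₁·𝔅Γ²e^δ·16dΓ + K₂(θ/4 + 1)(e^{δ(2d+1)} + a_max√|Cp|·𝔅·e^{δ(4d+1)})/c₀²)·
n(b₋)·e^{−δ·d_n(b₋,t_{k′})}·m` — ONE power of the local scale; constants seeing `d, c₀, c_max, a_max, C, κ, L, A, R, |Cp|, K₁, K₂`
ONLY.  NOT a bound on Bałaban's ∇_UG′(U): the MODEL with flat transport only.
[cite: Balaban1985BackgroundPropagators, Thm 3.1 (3.42) p.397; Balaban1983RegularityDecay, Lemma 2.2 (2.17) p.577] [folklore] -/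
theorem real_grad_dirInv_le_of_flatGradient (hflat : ∀ b k i, Rm b k i = if k = i then 1 else 0)
    {cmax : ℝ} (hc : ∀ b, |c b| ≤ cmax) {C : ℝ}
    (hcoer : ∀ f : UT N × Cp → ℝ,
      C * ∑ k, ((S (lvl k) : ℝ) ^ 2)⁻¹ * ∑ v : Box d (S (lvl k)), ∑ i, f (cellPt S hS hdivS lvl zc k v, i) ^ 2 ≤
        ∑ p, f p * levelOp bsrc btgt c Rm (fun l x => ctrU N (S l) (tblk (hS l) (hdivS l) x))
          (fun l x => ω l (ctrU N (S l) (tblk (hS l) (hdivS l) x))) T a f p)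
    {κ : ℝ} (hκ0 : 0 ≤ κ) (hκ1 : κ ≤ 1) (hμ : 0 < C - 2 * d * cmax ^ 2 * κ ^ 2 - amax * (Real.exp (2 * d * κ) - 1))
    (hrate : (1 + d / 2) * (Real.log L / R) ≤ κ)
    {Γ θ δ 𝔅 : ℝ} (hΓ : Γ = (L : ℝ) ^ A * Real.exp (Real.log L / R * (4 * d + 1))) (hθ : θ = 1 / (4 * d * Γ))
    (hδ : δ = κ - (1 + d / 2) * (Real.log L / R))
    (h𝔅 : 𝔅 = (max (Real.sqrt (11 ^ d)) (Cmv d * Real.sqrt (21 ^ d)) / Real.sqrt (θ ^ d) +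
            Real.sqrt (Fintype.card Cp) * (θ + 1) ^ 2 * (amax * Γ ^ 2 * Real.sqrt (Γ ^ d)) / (2 * c₀ ^ 2)) *
          (Real.sqrt (Fintype.card Cp) * Real.exp (κ * ((4 * d + 1) + 2 * d)) *
            ((L : ℝ) ^ A * Real.exp (Real.log L / R * (4 * d + 1))) * (L : ℝ) ^ A * Real.sqrt (((L : ℝ) ^ A) ^ d) /
            min (C - 2 * d * cmax ^ 2 * κ ^ 2 - amax * (Real.exp (2 * d * κ) - 1)) 1) +
          Real.sqrt (Fintype.card Cp) * (θ + 1) ^ 2 / (2 * c₀ ^ 2) *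
            Real.exp ((κ - (1 + d / 2) * (Real.log L / R)) * ((4 * d + 1) + 2 * d)))
    {K₁ K₂ : ℝ} (hK₁ : 0 ≤ K₁) (hK₂ : 0 ≤ K₂)
    (hFG : ∀ (x₀ : UT N) (R : ℕ), 1 ≤ R → (∀ i, 10 * R + 4 ≤ N i) → ∀ (w : UT N → ℝ) (M G : ℝ),
      (∀ x ∈ univ.filter (fun x : UT N => dist x x₀ ≤ 2 * R + 2), |w x| ≤ M) →
      (∀ x ∈ univ.filter (fun x : UT N => dist x x₀ ≤ 2 * R + 2),
        |((∑ b ∈ univ.filter (fun b : UT N × Fin d => btgt b = x), c b ^ 2) +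
              ∑ b ∈ univ.filter (fun b : UT N × Fin d => bsrc b = x), c b ^ 2) * w x -
            ((∑ b ∈ univ.filter (fun b : UT N × Fin d => btgt b = x), c b ^ 2 * w (bsrc b)) +
              ∑ b ∈ univ.filter (fun b : UT N × Fin d => bsrc b = x), c b ^ 2 * w (btgt b))| ≤ G) →
      ∀ μ, |w (up x₀ μ) - w x₀| ≤ K₁ * M / ((R : ℝ) + 1) + K₂ * ((R : ℝ) + 1) * G / c₀ ^ 2)
    (χ : UT N × Cp → ℝ) (hχ : ∀ p, χ p = 0 ∨ χ p = 1)
    (k' : K) (u : UT N × Cp → ℝ) (hu : ∀ p, cellOf S hS hdivS lvl zc hcover p.1 ≠ k' → u p = 0)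
    {m : ℝ} (hm : 0 ≤ m) (hum : ∀ p, |u p| ≤ m) (b : UT N × Fin d) (i : Cp)
    (hint : ∀ q : UT N × Cp, sdist bsrc btgt (siteScale S hS hdivS lvl zc hcover) q.1 (bsrc b) ≤ 8 * d + 2 → χ q = 1) :
    |covD bsrc btgt c Rm ((dirInv (levelOp bsrc btgt c Rm (fun l x => ctrU N (S l) (tblk (hS l) (hdivS l) x))
        (fun l x => ω l (ctrU N (S l) (tblk (hS l) (hdivS l) x))) T a) χ) u) (b, i)| ≤
      |c₀| * (𝔅 * (Γ ^ 2 * Real.exp δ + 1) * (16 * d * Γ) + K₁ * 𝔅 * Γ ^ 2 * Real.exp δ * (16 * d * Γ) +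
          K₂ * (θ / 4 + 1) * (Real.exp (δ * (2 * d + 1)) + amax * Real.sqrt (Fintype.card Cp) * 𝔅 * Real.exp (δ * (4 * d + 1))) /
            c₀ ^ 2) *
        (siteScale S hS hdivS lvl zc hcover (bsrc b) : ℝ) *
        Real.exp (-(δ * sdist bsrc btgt (siteScale S hS hdivS lvl zc hcover) (bsrc b) (ctrU N (S (lvl k')) (zc k')))) * m := by
  classical
  obtain ⟨x, μ⟩ := b
  simp only [bsrc_apply] at hint
  -- abbreviations
  set μ₀ := C - 2 * d * cmax ^ 2 * κ ^ 2 - amax * (Real.exp (2 * d * κ) - 1) with hμ₀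
  set Aop := levelOp bsrc btgt c Rm (fun l x => ctrU N (S l) (tblk (hS l) (hdivS l) x))
    (fun l x => ω l (ctrU N (S l) (tblk (hS l) (hdivS l) x))) T a with hAop
  set Pop := levelSum (fun l x => ctrU N (S l) (tblk (hS l) (hdivS l) x))
    (fun l x => ω l (ctrU N (S l) (tblk (hS l) (hdivS l) x))) T a with hPop
  set n := siteScale S hS hdivS lvl zc hcover with hn
  set tk' : UT N := ctrU N (S (lvl k')) (zc k') with htk'
  set f := (dirInv Aop χ) u with hf
  set D : ℝ := sdist bsrc btgt n x tk' with hD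
  set Kc := Real.sqrt (Fintype.card Cp) with hKc
  obtain ⟨i₀⟩ := ‹Nonempty Cp›
  -- positivity
  have hd1 : (1 : ℝ) ≤ d := by exact_mod_cast Nat.one_le_iff_ne_zero.mpr (NeZero.ne d)
  have hd0 : (0 : ℝ) < d := by linarith
  have hL1 : (1 : ℝ) ≤ L := by exact_mod_cast hL
  have ht0 : 0 ≤ Real.log L / R := div_nonneg (Real.log_nonneg hL1) hR.le
  have hΓ1 : 1 ≤ Γ := by
    rw [hΓ]
    exact one_le_mul_of_one_le_of_one_le (one_le_pow₀ hL1) (Real.one_le_exp (mul_nonneg ht0 (by positivity)))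
  have hΓ0 : 0 < Γ := by linarith
  have hdΓ : (1 : ℝ) ≤ d * Γ := one_le_mul_of_one_le_of_one_le hd1 hΓ1
  have h16 : (16 : ℝ) ≤ 16 * d * Γ := by
    have : (16 : ℝ) * d * Γ = 16 * (d * Γ) := by ring
    rw [this]; linarith
  have hθ0 : 0 < θ := by rw [hθ]; positivity
  have hθ4 : θ ≤ 1 / 4 := by
    rw [hθ]
    refine div_le_div_of_nonneg_left zero_le_one (by norm_num) ?_
    have : (4 : ℝ) * d * Γ = 4 * (d * Γ) := by ring
    rw [this]; linarith
  have hθΓ : θ * (16 * d * Γ) = 4 := by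
    rw [hθ]; field_simp; ring
  have hδ0 : 0 ≤ δ := by rw [hδ]; linarith
  have hc2 : (0 : ℝ) < c₀ ^ 2 := by positivity
  have hKc0 : 0 ≤ Kc := Real.sqrt_nonneg _
  have h𝔅0 : 0 ≤ 𝔅 := by rw [h𝔅]; positivity
  have hnpos : ∀ y, (0 : ℝ) < (n y : ℝ) := fun y => by exact_mod_cast one_le_siteScale S hS hdivS lvl zc hcover y
  have hn1 : ∀ y, (1 : ℝ) ≤ (n y : ℝ) := fun y => by exact_mod_cast one_le_siteScale S hS hdivS lvl zc hcover y
  -- `A f = u` ON THE DOMAIN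
  have hAf : ∀ q, χ q = 1 → Aop f q = u q := fun q hq =>
    levelOp_dirInv_apply_of_mem S hS hdivS lvl zc hdisj hcover Rm T a ω c (coer_pos_of_margin hamax hκ0 hμ) hcoer χ hχ u q hq
  have hgr : ∀ y, n y = L ^ (e (lvl (cellOf S hS hdivS lvl zc hcover y))) := fun y => by rw [hn, siteScale, hSe]
  -- THE CLOSED SUP MEMBER FOR THE DIRICHLET INVERSES («17-Dirichlet») at every site-component of the `(4d+1)`-ball about `x`
  have hsup : ∀ q : UT N × Cp, sdist bsrc btgt n q.1 x ≤ 4 * d + 1 →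
      |f q| ≤ 𝔅 * (n q.1 : ℝ) ^ 2 * Real.exp (-(δ * sdist bsrc btgt n q.1 tk')) * m := by
    intro q hq
    have hintq : ∀ q' : UT N × Cp, sdist bsrc btgt n q'.1 q.1 ≤ 4 * d + 1 → χ q' = 1 := by
      intro q' hq'
      refine hint q' ?_
      have htri := sdist_triangle_torus n q'.1 q.1 x
      linarith
    have h := real_sup_dirInv_le S hS hdivS lvl zc hdisj hcover Rm hRm T hT a ha ω hsupp hamax hscale c hc hcoer hκ0 hκ1 hcc hc₀
      hμ hL e hSe hR hadd hrate hΓ hθ χ hχ k' u hu hm hum q hintq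
    rw [← h𝔅, ← hδ] at h
    exact h
  -- (α) and (β₁) on the `d_n`-ball of radius 1 around `x`
  set M := 𝔅 * Γ ^ 2 * Real.exp δ * (n x : ℝ) ^ 2 * Real.exp (-(δ * D)) * m with hM
  have hM0 : 0 ≤ M := by rw [hM]; positivity
  have hα : ∀ (y : UT N) (j : Cp), sdist bsrc btgt n y x ≤ 1 → |f (y, j)| ≤ M := fun y j hy =>
    abs_le_on_unit_ball_loc S hS hdivS lvl zc hcover hL e hSe hR hadd hΓ hδ0 h𝔅0 hm f tk' hsup hy j
  set Pb := amax * Kc * 𝔅 * Real.exp (δ * (4 * d + 1)) * Real.exp (-(δ * D)) * m with hPb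
  have hPb0 : 0 ≤ Pb := by rw [hPb]; positivity
  have hβ₁ : ∀ (y : UT N) (j : Cp), sdist bsrc btgt n y x ≤ 1 → |Pop f (y, j)| ≤ Pb := fun y j hy =>
    abs_levelSum_le_on_unit_ball_loc S hS hdivS lvl zc hdisj hcover T hT a ha ω hsupp hamax hscale hδ0 h𝔅0 hm f tk' hsup hy j
  -- (β₂) the source `u` on the ball
  set Ub := Real.exp (δ * (2 * d + 1)) * Real.exp (-(δ * D)) * m with hUb
  have hUb0 : 0 ≤ Ub := by rw [hUb]; positivity
  have hthr := sdist_corner_thresholds S hS hdivS lvl zc hdisj hcover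
  have hβ₂ : ∀ (y : UT N) (j : Cp), sdist bsrc btgt n y x ≤ 1 → |u (y, j)| ≤ Ub := by
    intro y j hy
    by_cases hky : cellOf S hS hdivS lvl zc hcover y = k'
    · have h2d : sdist bsrc btgt n y tk' ≤ 2 * d := (hthr y k').1 hky
      have htri : D ≤ sdist bsrc btgt n x y + sdist bsrc btgt n y tk' := sdist_triangle_torus n x y tk'
      have hsym : sdist bsrc btgt n x y = sdist bsrc btgt n y x := sdist_comm bsrc btgt n x y
      have hexp : (1 : ℝ) ≤ Real.exp (δ * (2 * d + 1)) * Real.exp (-(δ * D)) := by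
        rw [← Real.exp_add]
        refine Real.one_le_exp ?_
        have : δ * D ≤ δ * (2 * d + 1) := mul_le_mul_of_nonneg_left (by linarith) hδ0
        linarith
      calc |u (y, j)| ≤ m := hum (y, j)
        _ = 1 * m := (one_mul m).symm
        _ ≤ Real.exp (δ * (2 * d + 1)) * Real.exp (-(δ * D)) * m := mul_le_mul_of_nonneg_right hexp hm
    · rw [hu (y, j) hky, abs_zero]; exact hUb0
  -- (β) the scalar equation of each component: `W·f_j − N f_j = u − Pop f`, bounded by `Ub + Pb` on the ball
  have hβ : ∀ (y : UT N) (j : Cp), sdist bsrc btgt n y x ≤ 1 →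
      |((∑ b ∈ univ.filter (fun b : UT N × Fin d => btgt b = y), c b ^ 2) +
            ∑ b ∈ univ.filter (fun b : UT N × Fin d => bsrc b = y), c b ^ 2) * f (y, j) -
          ((∑ b ∈ univ.filter (fun b : UT N × Fin d => btgt b = y), c b ^ 2 * f (bsrc b, j)) +
            ∑ b ∈ univ.filter (fun b : UT N × Fin d => bsrc b = y), c b ^ 2 * f (btgt b, j))| ≤ Ub + Pb := by
    intro y j hy
    have hsplit : covDT bsrc btgt c Rm (covD bsrc btgt c Rm f) (y, j) = u (y, j) - Pop f (y, j) := by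
      have : Aop f (y, j) = covDT bsrc btgt c Rm (covD bsrc btgt c Rm f) (y, j) + Pop f (y, j) := by
        rw [hAop, hPop, levelOp, LinearMap.add_apply, LinearMap.comp_apply, Pi.add_apply]
      have hd0' : (0 : ℝ) ≤ d := Nat.cast_nonneg d
      rw [hAf (y, j) (hint (y, j) (by dsimp only; linarith))] at this
      linarith
    rw [← covLap_flat_component hflat c f y j, hsplit]
    calc |u (y, j) - Pop f (y, j)| ≤ |u (y, j)| + |Pop f (y, j)| := abs_sub _ _
      _ ≤ Ub + Pb := add_le_add (hβ₂ y j hy) (hβ₁ y j hy)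
  -- the covariant derivative is the flat difference
  rw [covD_flat hflat c f (x, μ) i, hcc, bsrc_apply, btgt_apply, abs_mul]
  -- the three nonnegative constants
  set T1 := 𝔅 * (Γ ^ 2 * Real.exp δ + 1) * (16 * d * Γ) with hT1
  set T2 := K₁ * 𝔅 * Γ ^ 2 * Real.exp δ * (16 * d * Γ) with hT2
  set T3 := K₂ * (θ / 4 + 1) * (Real.exp (δ * (2 * d + 1)) + amax * Kc * 𝔅 * Real.exp (δ * (4 * d + 1))) / c₀ ^ 2 with hT3
  have hT1n : 0 ≤ T1 := by rw [hT1]; positivity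
  have hT2n : 0 ≤ T2 := by rw [hT2]; positivity
  have hT3n : 0 ≤ T3 := by rw [hT3]; positivity
  set E := (n x : ℝ) * Real.exp (-(δ * D)) * m with hE
  have hE0 : 0 ≤ E := by rw [hE]; positivity
  -- it suffices to bound the flat difference by `(T1 + T2 + T3)·E`
  suffices hkey : |f (up x μ, i) - f (x, i)| ≤ (T1 + T2 + T3) * E by
    calc |c₀| * |f (up x μ, i) - f (x, i)| ≤ |c₀| * ((T1 + T2 + T3) * E) := mul_le_mul_of_nonneg_left hkey (abs_nonneg _)
      _ = |c₀| * (T1 + T2 + T3) * (n x : ℝ) * Real.exp (-(δ * D)) * m := by rw [hE]; ring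
  -- the radius
  set R₀ : ℕ := ⌊(n x : ℝ) * θ / 4⌋₊ with hR₀
  have hR₀le : (R₀ : ℝ) ≤ n x * θ / 4 := Nat.floor_le (by positivity)
  have hR₀lt : (n x : ℝ) * θ / 4 < R₀ + 1 := Nat.lt_floor_add_one _
  by_cases hcase : 1 ≤ R₀ ∧ ∀ j, 10 * R₀ + 4 ≤ N j
  · -- CASE 2: the binder applies on the ball `dist(·,x) ≤ 2R₀ + 2`, which sits in the `d_n`-ball of radius 1
    obtain ⟨hR1, hroom⟩ := hcase
    have hballrad : ((d * (2 * R₀ + 2) : ℕ) : ℝ) * ((L : ℝ) ^ A * Real.exp (Real.log L / R * (4 * d + 1))) / n x ≤ 1 / 4 := by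
      rw [← hΓ, div_le_iff₀ (hnpos x)]
      push_cast
      have h4R : (2 * (R₀ : ℝ) + 2) ≤ 4 * R₀ := by
        have : (1 : ℝ) ≤ R₀ := by exact_mod_cast hR1
        linarith
      calc (d : ℝ) * (2 * R₀ + 2) * Γ ≤ d * (4 * R₀) * Γ := by gcongr
        _ ≤ d * (4 * (n x * θ / 4)) * Γ := by gcongr
        _ = n x * (θ * (16 * d * Γ)) / 16 := by ring
        _ = 1 / 4 * n x := by rw [hθΓ]; ring
    have hquarter : (1 : ℝ) / 4 ≤ 4 * d + 1 := by linarith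
    have hball : ∀ y, dist y x ≤ ((2 * R₀ + 2 : ℕ) : ℝ) → sdist bsrc btgt n y x ≤ 1 := fun y hy =>
      ((sdist_le_of_dist_le n (one_le_siteScale S hS hdivS lvl zc hcover) hL
        (fun y => e (lvl (cellOf S hS hdivS lvl zc hcover y))) hgr hR x (fun y => hadd y x) (2 * R₀ + 2)
        (hballrad.trans hquarter) hy).trans hballrad).trans (by norm_num)
    have hcast : ((2 * R₀ + 2 : ℕ) : ℝ) = 2 * (R₀ : ℝ) + 2 := by push_cast; ring
    have hball' : ∀ y ∈ univ.filter (fun y : UT N => dist y x ≤ 2 * R₀ + 2), sdist bsrc btgt n y x ≤ 1 := by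
      intro y hy
      have h := (mem_filter.mp hy).2
      exact hball y (by rw [hcast]; exact h)
    have hFGx := hFG x R₀ hR1 hroom (fun y => f (y, i)) M (Ub + Pb)
      (fun y hy => hα y i (hball' y hy)) (fun y hy => hβ y i (hball' y hy)) μ
    -- `1/(R₀+1) ≤ 16dΓ/n(x)` and `R₀ + 1 ≤ (θ/4 + 1)·n(x)`
    have hR1' : (0 : ℝ) < (R₀ : ℝ) + 1 := by positivity
    have hnR : (n x : ℝ) ≤ ((R₀ : ℝ) + 1) * (16 * d * Γ) := by
      have : (n x : ℝ) * θ / 4 * (16 * d * Γ) < ((R₀ : ℝ) + 1) * (16 * d * Γ) :=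
        mul_lt_mul_of_pos_right hR₀lt (by positivity)
      have e1 : (n x : ℝ) * θ / 4 * (16 * d * Γ) = n x * (θ * (16 * d * Γ)) / 4 := by ring
      rw [e1, hθΓ] at this
      linarith
    have hinv : M / ((R₀ : ℝ) + 1) ≤ M * (16 * d * Γ) / n x := by
      rw [div_le_div_iff₀ hR1' (hnpos x)]
      calc M * (n x : ℝ) ≤ M * (((R₀ : ℝ) + 1) * (16 * d * Γ)) := mul_le_mul_of_nonneg_left hnR hM0
        _ = M * (16 * d * Γ) * ((R₀ : ℝ) + 1) := by ring
    have hRle : (R₀ : ℝ) + 1 ≤ (θ / 4 + 1) * n x := by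
      have : (θ / 4 + 1) * (n x : ℝ) = n x * θ / 4 + n x := by ring
      rw [this]; linarith [hn1 x]
    have hMx : M * (16 * d * Γ) / n x = 𝔅 * Γ ^ 2 * Real.exp δ * (16 * d * Γ) * E := by
      rw [hM, hE, div_eq_iff (hnpos x).ne']
      ring
    have hfirst : K₁ * M / ((R₀ : ℝ) + 1) ≤ T2 * E := by
      calc K₁ * M / ((R₀ : ℝ) + 1) = K₁ * (M / ((R₀ : ℝ) + 1)) := by ring
        _ ≤ K₁ * (M * (16 * d * Γ) / n x) := mul_le_mul_of_nonneg_left hinv hK₁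
        _ = T2 * E := by rw [hMx, hT2]; ring
    have hUP : Ub + Pb = (Real.exp (δ * (2 * d + 1)) + amax * Kc * 𝔅 * Real.exp (δ * (4 * d + 1))) *
        (Real.exp (-(δ * D)) * m) := by rw [hUb, hPb]; ring
    have hUP0 : 0 ≤ Ub + Pb := add_nonneg hUb0 hPb0
    have hsecond : K₂ * ((R₀ : ℝ) + 1) * (Ub + Pb) / c₀ ^ 2 ≤ T3 * E := by
      have h1 : K₂ * ((R₀ : ℝ) + 1) * (Ub + Pb) ≤ K₂ * ((θ / 4 + 1) * n x) * (Ub + Pb) :=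
        mul_le_mul_of_nonneg_right (mul_le_mul_of_nonneg_left hRle hK₂) hUP0
      calc K₂ * ((R₀ : ℝ) + 1) * (Ub + Pb) / c₀ ^ 2 ≤ K₂ * ((θ / 4 + 1) * n x) * (Ub + Pb) / c₀ ^ 2 :=
            div_le_div_of_nonneg_right h1 hc2.le
        _ = T3 * E := by rw [hT3, hE, hUP]; ring
    calc |f (up x μ, i) - f (x, i)| ≤ K₁ * M / ((R₀ : ℝ) + 1) + K₂ * ((R₀ : ℝ) + 1) * (Ub + Pb) / c₀ ^ 2 := hFGx
      _ ≤ T2 * E + T3 * E := add_le_add hfirst hsecond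
      _ = (T2 + T3) * E := by ring
      _ ≤ (T1 + T2 + T3) * E := mul_le_mul_of_nonneg_right (by linarith) hE0
  · -- CASE 1: small scale `n(x) ≤ 16dΓ`; the trivial bound
    have hnx : (n x : ℝ) ≤ 16 * d * Γ := by
      by_cases hR1 : 1 ≤ R₀
      · -- the torus is too small for the room condition: `N_j < 10R₀ + 4` forces `n(x) ≤ 10`
        have hex : ∃ j, N j < 10 * R₀ + 4 := by
          by_contra hcon
          push Not at hcon
          exact hcase ⟨hR1, hcon⟩
        obtain ⟨j, hj⟩ := hex
        have hnN : n x ≤ N j := Nat.le_of_dvd (Nat.pos_of_ne_zero (NeZero.ne _)) (by rw [hn]; exact hdivS _ j)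
        have hjR : (N j : ℝ) < 10 * R₀ + 4 := by exact_mod_cast hj
        have hnNR : (n x : ℝ) ≤ N j := by exact_mod_cast hnN
        have hRn : (R₀ : ℝ) ≤ n x / 16 := by
          have : (n x : ℝ) * θ ≤ n x * (1 / 4) := mul_le_mul_of_nonneg_left hθ4 (hnpos x).le
          calc (R₀ : ℝ) ≤ n x * θ / 4 := hR₀le
            _ ≤ n x * (1 / 4) / 4 := by linarith
            _ = n x / 16 := by ring
        linarith
      · push Not at hR1
        have hR0 : R₀ = 0 := by omega
        have hlt : (n x : ℝ) * θ / 4 < 1 := by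
          have h := hR₀lt
          rw [hR0] at h
          simpa using h
        have : (n x : ℝ) * θ / 4 * (16 * d * Γ) < 1 * (16 * d * Γ) := mul_lt_mul_of_pos_right hlt (by positivity)
        have e1 : (n x : ℝ) * θ / 4 * (16 * d * Γ) = n x * (θ * (16 * d * Γ)) / 4 := by ring
        rw [e1, hθΓ] at this
        linarith
    have hup_x : sdist bsrc btgt n (up x μ) x ≤ 1 := by
      have h := abs_sdist_tgt_sub_src_le bsrc btgt n (x, μ) x
      rw [bsrc_apply, btgt_apply, sdist_self] at h
      have h1 := (abs_sub_le_iff.mp h).1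
      have h2 := slen_le_one n (one_le_siteScale S hS hdivS lvl zc hcover) x (up x μ)
      linarith
    have h1 := hα (up x μ) i hup_x
    have h2 : |f (x, i)| ≤ 𝔅 * (n x : ℝ) ^ 2 * Real.exp (-(δ * D)) * m :=
      hsup (x, i) (by dsimp only; rw [sdist_self]; positivity)
    have hnx0 : (0 : ℝ) ≤ n x := (hnpos x).le
    calc |f (up x μ, i) - f (x, i)| ≤ |f (up x μ, i)| + |f (x, i)| := abs_sub _ _
      _ ≤ M + 𝔅 * (n x : ℝ) ^ 2 * Real.exp (-(δ * D)) * m := add_le_add h1 h2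
      _ = 𝔅 * (Γ ^ 2 * Real.exp δ + 1) * (n x : ℝ) * E := by rw [hM, hE]; ring
      _ ≤ 𝔅 * (Γ ^ 2 * Real.exp δ + 1) * (16 * d * Γ) * E :=
          mul_le_mul_of_nonneg_right (mul_le_mul_of_nonneg_left hnx (by positivity)) hE0
      _ = T1 * E := by rw [hT1]
      _ ≤ (T1 + T2 + T3) * E := mul_le_mul_of_nonneg_right (by linarith) hE0


end Main

end

end Summit.QuantumFields.BalabanUV.Beta.MultiscaleGradientMemberDirichlet
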